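import Summits.BirchSwinnertonDyer.BirchSwinnertonDyer.Theorems.KolyvaginDepthDoorDepthTableKuriharaDecisivePrime
import Summits.BirchSwinnertonDyer.BirchSwinnertonDyer.Theorems.KolyvaginDepthDoorDepthTableKuriharaExactRow
import Summits.BirchSwinnertonDyer.BirchSwinnertonDyer.Theorems.KolyvaginDepthDoorDepthTableKuriharaSocket707a1
import Summits.BirchSwinnertonDyer.BirchSwinnertonDyer.Theorems.KolyvaginDepthDoorDepthTableRow707a1RankDischarged
import Summits.BirchSwinnertonDyer.Rank1Residual.Supersingular.CountPointsFast
import HarnessLib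

/-!
# Route `KolyvaginDepthDoor`, crux `KolyvaginDepthSupplyKN` (stmt-BirchSwinnertonDyer-22820) —
# DEPTH TABLE v20, ROW `707a1` @ `(11, d_K = -19)`: the EXACT depth-one reading at `11` and THE DECISIVE PRIME `ℓ★ = 463`
# — the row's bit ⟺ a unit mod-`11` Kurihara number of the twist model `T₀ = [0, -1, 1, -4452, -110483]` AT THE ONE PRIME
# `463` (kernel: `40 • P̄ ≠ O` in `T̃₀(𝔽_463)` for the tree's twist point `P = (71729/256, 18570793/4096)`, `#T̃₀(𝔽_463) = 440 = 11·40`)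

Helper file of the lead prover of line `levelone` (kdd-p1 g24; `--supports stmt-BirchSwinnertonDyer-22820
--as helper`); it closes nothing and BSD is NOT proved by it. Same template as `…KuriharaDecisive655a1` (this generation):
exact reading as `…KuriharaSocket681c1`, decisive prime as `…KuriharaDecisive681c1` (rational-point bridge).

v19 (g23, `…KuriharaSocket707a1`) gave this row a SOCKET only — «no exact depth-one reading here» and, in CLOSING-DATA-v19,
«no rational point of small height found on `T₀`» (integral search `|x| ≤ 2·10⁵`). Both gaps close from material ALREADY IN
THE TREE: (i) `rank 707a1 = 2` IS a kernel theorem (`Rank2Observatory.C707a1.mordellWeilRank_eq_two`, general 2-descent) and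
`Ш(707a1)[11] = 0` from the record `cert_707a1` @ `(11, 463·1277)` is g21's `C707a1.sha_inf_torsionBy_eq_bot_of_kuriharaClaim_11`,
so the ♠ generic rank-two row `kolyvaginClass_prime_ne_zero_iff_shaTrivial_twistSelmer_of_rank_two_of_lemma84` ((γ) + W. Zhang
L8.4 (1) by name) ∘ v18's twist IFF (Sakamoto Thm. 1.2/1.5 + Kim Thm. 1.11 by name) give the exact reading at `(11, −19)`;
(ii) the kernel twist point of the v12 table (g16, `C707a1.one_le_rank_twist_neg19`: `(73265/64, 18572841/512)` on the `u = 1/2`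
model `[0, -76, 0, -69312, -5377456]`) transports to `P = (71729/256, 18570793/4096)` on the minimal model `T₀` (`x = X/4 − 6`,
`y = Y/8 − 1/2`; denominators `2⁸`, `2¹²`), and at the least cyclic Kolyvagin prime `463` of `(T₀, 11)` (`#T̃₀(𝔽_463) = 440`,
`a_463 = 24 ≡ 2 (mod 11)`; `463` is also the first prime of the E-side record) its reduction `P̄ = (282, 178)` has
`40 • P̄ = (292, 223) ≠ O` (6-step chain, `decide`), so `P ∉ 11·T₀(ℚ_463)` by `localNondivisible_of_chainB_rat`. HENCE

* `kolyvaginPrime_iff_twistKuriharaBit_11_neg19` — **THE EXACT DEPTH-ONE READING** at `(11, −19)`.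
* `twistKuriharaBit_iff_unit_463` — **bit ⟺ unit `δ̃_463(T₀)`**: the fleet's ONE residue `δ̃_463(T₀) mod 11` DECIDES the row
  `707a1` @ `(11, −19)` BOTH WAYS modulo print. `N_{T₀} = 255227` (the smallest twist conductor of the open rows); the cyclic
  Kolyvagin primes of `(T₀, 11)` below `3000` are `463, 1277` (both ★ for `P`).

Kernel lemmas: `minTwist19_card_463`, `minTwist19_isCyclicKolyvaginLevel_11_463`, `minTwist19_nonsingular_P`, `chain463_mult/_ok`,
`minTwist19_localNondivisible_463`. CONDITIONAL on the named facts displayed and the E-side record claim `hδE`; per curve;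
nothing class-wide; BSD is NOT proved by any of this.

References: [Sakamoto2022pSelmer] Lemma 4.4, Lemma 4.6 (1), Thm. 1.2, Thm. 1.5; [Kim2022StructureSelmer] Thm. 1.11, §1.2.2;
[WZhang2014] Lemma 8.4 (1), Thm. 9.1; [GrossLMS1991] Prop. 3.7 (2); [Kurihara2014] §5.3; [SilvermanAEC2009] III.2.3, VII.2.1,
VII.3.1, X.4.2, X.5 Cor. 5.4; [CremonaAlgorithms1997] Table 1 (707a1), §3.6.
-/

set_option linter.dupNamespace false

noncomputable section

open scoped Classical NumberField

namespace Summit.BirchSwinnertonDyer.BirchSwinnertonDyer.Theorems.KolyvaginDepthDoor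

open Literature.NumberTheory.EllipticCurves Literature.NumberTheory.EllipticCurves.ModularForms
  WeierstrassCurve NumberField IsDedekindDomain
open Summit.BirchSwinnertonDyer.BirchSwinnertonDyer.Theorems
open Summit.BirchSwinnertonDyer.BirchSwinnertonDyer.Rank2Observatory
open Summit.BirchSwinnertonDyer.BirchSwinnertonDyer.Rank1Residual (IntModel.frobeniusTrace_eq)
open Summit.BirchSwinnertonDyer.Rank1Residual.Supersingular (natCard_point_eq_of_countPoints countPoints_eq_of_fast)
open Summit.BirchSwinnertonDyer.Rank1Residual.Additive (card_torsion_le_of_intModel_of_card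
  isKolyvaginPrime_of_intModel_of_card)

namespace C707a1

/-! ## §1 The exact depth-one reading of row `707a1` at `(11, −19)` -/

/-- **THE EXACT DEPTH-ONE READING of row `707a1` @ `(11, −19)` in Kurihara currency.** Granted the E-side claim `hδE`
(record `cert_707a1` @ `(11, 463·1277)`; with Kim Thm. 1.11 it gives `Ш(707a1)[11] = 0`) and the named facts displayed:
for every `K` with `d_K = −19`, «some frame, some Kolyvagin PRIME `ℓ`, some Kolyvagin–Heegner datum of conductor `ℓ` with
`c_1(ℓ) ≠ 0`» holds IF AND ONLY IF «for every datum `D` of `T₀ = [0, 0, 1, -33813, -2420881]` at level `N_{T₀}` with `11 ∤ c_D`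
and the period transfer, some cyclic Kolyvagin level `m` of `(T₀, 11)` with `ν(m) ≤ 1` carries a unit mod-`11` Kurihara number» —
g14's generic rank-two row (`kolyvaginClass_prime_ne_zero_iff_shaTrivial_twistSelmer_of_rank_two_of_lemma84`, (γ) + W. Zhang
by name, `rank 707a1 = 2` by the kernel 2-descent `Rank2Observatory.C707a1.mordellWeilRank_eq_two`) ∘ v18's twist IFF (Sakamoto
Thm. 1.2/1.5 + Kim Thm. 1.11 + modularity + Mazur by name). CONDITIONAL on the seven named facts and the claim `hδE`; per curve;
BSD is not proved by it. [cite: Sakamoto2022pSelmer, Thm. 1.2, Thm. 1.5] [cite: Kim2022StructureSelmer, Thm. 1.11]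
[cite: WZhang2014, Lemma 8.4 (1) (p. 236)] [cite: GrossLMS1991, Prop. 3.7 (2), §5 (5.1)] [cite: CremonaAlgorithms1997, Table 1 (707a1)] -/
theorem kolyvaginPrime_iff_twistKuriharaBit_11_neg19
    (h372 : GrossLMS1991.prop37_2_frobeniusCongruence)
    (h84 : Literature.NumberTheory.EllipticCurves.WZhang2014_lemma84_exists_minimal_kolyvaginClass_one_selmerCard)
    (hKim : Kim2022_card_selmerGroup_le_pow_of_kuriharaNumber_ne_zero)
    (hSak1 : Sakamoto2022_card_selmerGroup_eq_pow_of_isDeltaMinimal)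
    (hSak2 : Sakamoto2022_exists_cyclicLevel_kuriharaNumber_ne_zero)
    (hnf : exists_isNewformOf) (hMaz : mazur_not_dvd_maninConstant_of_odd)
    (K : Type) [Field K] [NumberField K] (hK : IsImaginaryQuadratic K) (hD : NumberField.discr K = -19)
    (hδE : haveI := isElliptic_c707a1; haveI := isGloballyMinimal_c707a1;
      haveI : NeZero (((⟨0, 1, 1, -12, 12⟩ : WeierstrassCurve ℤ).map (Int.castRingHom ℚ)).conductorNorm ℤ) := neZero_conductorNorm_of_isElliptic _;
      haveI := Fact.mk (by norm_num : Nat.Prime 11);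
      ∀ (D : ModularParametrizationData ((⟨0, 1, 1, -12, 12⟩ : WeierstrassCurve ℤ).map (Int.castRingHom ℚ)) (((⟨0, 1, 1, -12, 12⟩ : WeierstrassCurve ℤ).map (Int.castRingHom ℚ)).conductorNorm ℤ)), ¬ ((11 : ℕ) : ℤ) ∣ D.maninConstant →
        (∃ u : ℚ, ‖(u : ℚ_[11])‖ = 1 ∧ ((⟨0, 1, 1, -12, 12⟩ : WeierstrassCurve ℤ).map (Int.castRingHom ℚ)).realPeriodRat = u * plusPeriod D.f) →
        ∃ ψ : (ℓ : ℕ) → (ZMod ℓ)ˣ →* Multiplicative (ZMod 11),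
          (∀ ℓ ∈ (591251 : ℕ).primeFactors, Function.Surjective (ψ ℓ)) ∧ kuriharaNumber D.f 11 591251 ψ ≠ 0) :
    haveI := isElliptic_c707a1; haveI := isGloballyMinimal_c707a1;
    haveI : NeZero (((⟨0, 1, 1, -12, 12⟩ : WeierstrassCurve ℤ).map (Int.castRingHom ℚ)).conductorNorm ℤ) := neZero_conductorNorm_of_isElliptic _;
    haveI := minTwist19_isElliptic; haveI := minTwist19_isGloballyMinimal;
    haveI : NeZero (((⟨0, -1, 1, -4452, -110483⟩ : WeierstrassCurve ℤ).map (Int.castRingHom ℚ)).conductorNorm ℤ) := neZero_conductorNorm_of_isElliptic _;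
    haveI := Fact.mk (by norm_num : Nat.Prime 11);
    (∃ (Dt : ModularParametrizationData ((⟨0, 1, 1, -12, 12⟩ : WeierstrassCurve ℤ).map (Int.castRingHom ℚ)) (((⟨0, 1, 1, -12, 12⟩ : WeierstrassCurve ℤ).map (Int.castRingHom ℚ)).conductorNorm ℤ)) (β : ℤ)
      (ι : K →+* ℂ) (ℓ : ℕ) (d : KolyvaginHeegnerData Dt β ι ℓ),
      ℓ.Prime ∧ Zhang2014.IsKolyvaginPrime (((⟨0, 1, 1, -12, 12⟩ : WeierstrassCurve ℤ).map (Int.castRingHom ℚ)).conductorNorm ℤ) ((⟨0, 1, 1, -12, 12⟩ : WeierstrassCurve ℤ).map (Int.castRingHom ℚ)) K 11 ℓ ∧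
        d.kolyvaginClass (p := 11) (by norm_num) 1 ≠ 0) ↔
    (∀ (D : ModularParametrizationData ((⟨0, -1, 1, -4452, -110483⟩ : WeierstrassCurve ℤ).map (Int.castRingHom ℚ))
          (((⟨0, -1, 1, -4452, -110483⟩ : WeierstrassCurve ℤ).map (Int.castRingHom ℚ)).conductorNorm ℤ)),
        ¬ ((11 : ℕ) : ℤ) ∣ D.maninConstant →
        (∃ u : ℚ, ‖(u : ℚ_[11])‖ = 1 ∧
          ((⟨0, -1, 1, -4452, -110483⟩ : WeierstrassCurve ℤ).map (Int.castRingHom ℚ)).realPeriodRat = u * plusPeriod D.f) →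
        ∃ (m : ℕ) (_ : NeZero m), IsCyclicKolyvaginLevel ((⟨0, -1, 1, -4452, -110483⟩ : WeierstrassCurve ℤ).map (Int.castRingHom ℚ)) 11 m ∧
          m.primeFactors.card ≤ 1 ∧
          ∃ ψ : (ℓ : ℕ) → (ZMod ℓ)ˣ →* Multiplicative (ZMod 11),
            (∀ ℓ ∈ m.primeFactors, Function.Surjective (ψ ℓ)) ∧ kuriharaNumber D.f 11 m ψ ≠ 0) := by
  haveI := isElliptic_c707a1
  haveI := isGloballyMinimal_c707a1
  haveI iNZ : NeZero (((⟨0, 1, 1, -12, 12⟩ : WeierstrassCurve ℤ).map (Int.castRingHom ℚ)).conductorNorm ℤ) :=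
    neZero_conductorNorm_of_isElliptic _
  haveI := minTwist19_isElliptic
  haveI := minTwist19_isGloballyMinimal
  haveI iNZT : NeZero (((⟨0, -1, 1, -4452, -110483⟩ : WeierstrassCurve ℤ).map (Int.castRingHom ℚ)).conductorNorm ℤ) :=
    neZero_conductorNorm_of_isElliptic _
  haveI iP := Fact.mk (by norm_num : Nat.Prime 11)
  have hsha := sha_inf_torsionBy_eq_bot_of_kuriharaClaim_11 hKim hnf hMaz hδE
  have hsur : ((⟨0, 1, 1, -12, 12⟩ : WeierstrassCurve ℤ).map (Int.castRingHom ℚ)).HasSurjectiveModNGaloisRep ((11 : ℕ) : ℤ) := by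
    simpa using hasSurjectiveModNGaloisRep_11
  have hpD : ¬ (((11 : ℕ) : ℤ) ∣ NumberField.discr K) := by rw [hD]; decide
  have hC : (⟨1, (-6 : ℚ), (0 : ℚ), -((1 : ℚ) / 2)⟩ : WeierstrassCurve.VariableChange ℚ) • ((⟨0, -1, 1, -4452, -110483⟩ : WeierstrassCurve ℤ).map (Int.castRingHom ℚ)) =
      ((⟨0, 1, 1, -12, 12⟩ : WeierstrassCurve ℤ).map (Int.castRingHom ℚ)).quadraticTwist ((NumberField.discr K : ℤ) : ℚ) := by
    rw [hD]; push_cast; exact minTwist19_smul_eq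
  have htower : ∀ k : ℕ, ((⟨0, 1, 1, -12, 12⟩ : WeierstrassCurve ℤ).map (Int.castRingHom ℚ)).HasSurjectiveModNGaloisRep ((11 : ℕ) ^ k : ℕ) :=
    serre_hasSurjectiveModNGaloisRep_pow_holds _ 11 (by norm_num) hsur
  have hsp := spadeOne_of_five_le 11 (by norm_num)
  have hS2 : ¬ Squarefree (((⟨0, 1, 1, -12, 12⟩ : WeierstrassCurve ℤ).map (Int.castRingHom ℚ)).conductorNorm ℤ) →
      (∃ (ℓ : ℕ) (_ : Fact ℓ.Prime), ((⟨0, 1, 1, -12, 12⟩ : WeierstrassCurve ℤ).map (Int.castRingHom ℚ)).HasMultiplicativeReductionAtPrime ℓ ∧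
          ¬ 11 ∣ padicValInt ℓ ((⟨0, 1, 1, -12, 12⟩ : WeierstrassCurve ℤ).map (Int.castRingHom ℚ)).minimalDiscriminantInt) ∧
        ∃ (ℓ₁ ℓ₂ : ℕ) (_ : Fact ℓ₁.Prime) (_ : Fact ℓ₂.Prime), ℓ₁ ≠ ℓ₂ ∧
          ((⟨0, 1, 1, -12, 12⟩ : WeierstrassCurve ℤ).map (Int.castRingHom ℚ)).HasMultiplicativeReductionAtPrime ℓ₁ ∧
          ((⟨0, 1, 1, -12, 12⟩ : WeierstrassCurve ℤ).map (Int.castRingHom ℚ)).HasMultiplicativeReductionAtPrime ℓ₂ :=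
    fun hns ↦ absurd ((((⟨0, 1, 1, -12, 12⟩ : WeierstrassCurve ℤ).map (Int.castRingHom ℚ))).isSemistable_iff_squarefree_conductorNorm.mp hsp.2) hns
  have hH := satisfiesHeegnerHypothesis_conductorNorm_of_intModel intModel K hK.1 hD heegner_neg19
  have hD3 : NumberField.discr K ≠ -3 := by rw [hD]; norm_num
  have hD4 : NumberField.discr K ≠ -4 := by rw [hD]; norm_num
  have hr2 := Summit.BirchSwinnertonDyer.BirchSwinnertonDyer.Rank2Observatory.C707a1.mordellWeilRank_eq_two
  have hT := natCard_selmerGroup_quadraticTwist_le_iff_kuriharaBit hKim hSak1 hSak2 hnf hMaz _ 11 (by norm_num) goodOrdinary_11.1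
    goodOrdinary_11.2 hsur (NumberField.discr_ne_zero K) hpD _ _ hC minTwist19_nonAnomalous_11
    minTwist19_kodairaNeron_11 1
  rw [pow_one] at hT
  rw [kolyvaginClass_prime_ne_zero_iff_shaTrivial_twistSelmer_of_rank_two_of_lemma84 h372 h84 _ not_hasCM 11 (by norm_num)
    goodOrdinary_11.1 goodOrdinary_11.2 htower (kodairaNeron_of_five_le 11 (by norm_num)) hsp.1 hS2 K hK hD3 hD4 hpD hH hr2,
    and_iff_right hsha]
  exact hT

/-! ## §2 Kernel: `463` is a cyclic Kolyvagin prime of `(T₀, 11)` at which the tree's twist point is locally `11`-indivisible -/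

/-- `#T̃₀(𝔽_463) = 440 = 11·40` for `T₀ = [0, -1, 1, -4452, -110483]` (`463 ≡ 1 (mod 11)`, `a_463(T₀) = 24 ≡ 2 (mod 11)`, `11² ∤ 440`),
kernel-decided (`countPointsFast`). [cite: Kim2022StructureSelmer, §1.2.2 (PDF p. 5)] -/
theorem minTwist19_card_463 :
    Nat.card (((⟨0, -1, 1, -4452, -110483⟩ : WeierstrassCurve ℤ).map (Int.castRingHom (ZMod 463))).toAffine.Point) = 440 :=
  haveI : Fact (Nat.Prime 463) := ⟨by norm_num⟩
  natCard_point_eq_of_countPoints 0 (-1) 1 (-4452) (-110483) 463 (by norm_num) (by decide +kernel) (n := 440)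
    (countPoints_eq_of_fast (by decide +kernel))

/-- **`463` is a CYCLIC KOLYVAGIN PRIME for `(T₀, 11)`** (`463 ∤ 11·N_{T₀}`, `463 ≡ 1`, `a_463(T₀) ≡ 2 (mod 11)`, `#T̃₀(𝔽_463)[11] ≤ 11`).
[cite: Kim2022StructureSelmer, §1.2.2 (PDF p. 5)] -/
theorem minTwist19_isCyclicKolyvaginLevel_11_463 :
    haveI := minTwist19_isGloballyMinimal; haveI := Fact.mk (by norm_num : Nat.Prime 11);
    IsCyclicKolyvaginLevel ((⟨0, -1, 1, -4452, -110483⟩ : WeierstrassCurve ℤ).map (Int.castRingHom ℚ)) 11 463 := by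
  haveI := minTwist19_isElliptic
  haveI := minTwist19_isGloballyMinimal
  haveI := Fact.mk (by norm_num : Nat.Prime 11)
  haveI : Fact (Nat.Prime 463) := ⟨by norm_num⟩
  have hℓ : Kato.IsKolyvaginPrime ((⟨0, -1, 1, -4452, -110483⟩ : WeierstrassCurve ℤ).map (Int.castRingHom ℚ)) 11 1 463 :=
    isKolyvaginPrime_of_intModel_of_card minTwist19_intModel 11 1 463 (by norm_num) (by decide +kernel) (by decide)
      minTwist19_card_463 (by norm_num)
  refine ⟨⟨Nat.squarefree_iff_nodup_primeFactorsList (by norm_num) |>.mpr (by simp), fun ℓ hℓ' ↦ ?_⟩, fun ℓ hℓ' hdvd ↦ ?_⟩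
  · rw [show (463 : ℕ).primeFactors = {463} from (Nat.Prime.primeFactors (by norm_num)), Finset.mem_singleton] at hℓ'
    exact hℓ' ▸ hℓ
  · obtain rfl := (Nat.prime_dvd_prime_iff_eq hℓ'.out (by norm_num)).mp hdvd
    exact card_torsion_le_of_intModel_of_card minTwist19_intModel 11 463 minTwist19_card_463 (by norm_num)

/-- The rational point `P = (71729/256, 18570793/4096)` of `T₀ = [0, -1, 1, -4452, -110483]` (denominators powers of primes `≠ 463`; on the curve). [folklore] -/
theorem minTwist19_nonsingular_P :
    ((⟨0, -1, 1, -4452, -110483⟩ : WeierstrassCurve ℤ).map (Int.castRingHom ℚ)).toAffine.Nonsingular ((71729 : ℚ) / 256) ((18570793 : ℚ) / 4096) :=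
  nonsingular_rat_of_eq_rat _ (by decide +kernel) (by norm_num)

/-- The double-and-add chain from `P̄` reaches the multiplier `40`. [folklore] -/
theorem chain463_mult :
    chainMult 1 [(true, ((146 : ℤ) : ZMod 463), ((31 : ℤ) : ZMod 463)), (true, ((238 : ℤ) : ZMod 463), ((232 : ℤ) : ZMod 463)), (false, ((111 : ℤ) : ZMod 463), ((11 : ℤ) : ZMod 463)), (true, ((78 : ℤ) : ZMod 463), ((217 : ℤ) : ZMod 463)), (true, ((397 : ℤ) : ZMod 463), ((55 : ℤ) : ZMod 463)), (true, ((292 : ℤ) : ZMod 463), ((223 : ℤ) : ZMod 463))] = 40 := by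
  decide

/-- The double-and-add chain from `P̄ = (282, 178)` to `40 • P̄ = (292, 223)` in `T̃₀(𝔽_463)` CHECKS (tangent / chord
certificates, `decide`). [cite: SilvermanAEC2009, III.2.3] -/
theorem chain463_ok :
    chainB (⟨0, -1, 1, -4452, -110483⟩ : WeierstrassCurve ℤ) 463 (((282 : ℤ)) : ZMod 463) (((178 : ℤ)) : ZMod 463)
      ((((282 : ℤ)) : ZMod 463), (((178 : ℤ)) : ZMod 463))
      [(true, ((146 : ℤ) : ZMod 463), ((31 : ℤ) : ZMod 463)), (true, ((238 : ℤ) : ZMod 463), ((232 : ℤ) : ZMod 463)), (false, ((111 : ℤ) : ZMod 463), ((11 : ℤ) : ZMod 463)), (true, ((78 : ℤ) : ZMod 463), ((217 : ℤ) : ZMod 463)), (true, ((397 : ℤ) : ZMod 463), ((55 : ℤ) : ZMod 463)), (true, ((292 : ℤ) : ZMod 463), ((223 : ℤ) : ZMod 463))] = true := by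
  decide +kernel

/-- **KERNEL: `P = (71729/256, 18570793/4096)` is not divisible by `11` in `T₀(ℚ_463)`** — the chain certifies `40 • P̄ ≠ O` in
`T̃₀(𝔽_463)` for the reduction `P̄ = (282, 178)`, `11·40 = #T̃₀(𝔽_463)`, and `localNondivisible_of_chainB_rat`.
[cite: SilvermanAEC2009, III.2.3, VII.2 Prop. 2.1, VII.3 Prop. 3.1] -/
theorem minTwist19_localNondivisible_463 :
    haveI : Fact (Nat.Prime 463) := ⟨by norm_num⟩;
    ∀ Q : (((⟨0, -1, 1, -4452, -110483⟩ : WeierstrassCurve ℤ).map (Int.castRingHom ℚ)).baseChange ℚ_[463]).toAffine.Point,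
      11 • Q ≠ WeierstrassCurve.Affine.Point.map (W' := ((⟨0, -1, 1, -4452, -110483⟩ : WeierstrassCurve ℤ).map (Int.castRingHom ℚ)).toAffine)
        (S := ℚ) (Algebra.ofId ℚ ℚ_[463]) (.some ((71729 : ℚ) / 256) ((18570793 : ℚ) / 4096) minTwist19_nonsingular_P) := by
  haveI : Fact (Nat.Prime 463) := ⟨by norm_num⟩
  have hq : ¬ ((463 : ℕ) : ℤ) ∣ (⟨0, -1, 1, -4452, -110483⟩ : WeierstrassCurve ℤ).Δ := by decide +kernel
  have hx : ¬ (463 : ℕ) ∣ (((71729 : ℚ) / 256)).den := by decide +kernel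
  have hy : ¬ (463 : ℕ) ∣ (((18570793 : ℚ) / 4096)).den := by decide +kernel
  have hm : ((463 : ℕ) : ℤ) ∣ (((71729 : ℚ) / 256)).num - (282 : ℤ) * (((71729 : ℚ) / 256)).den := by decide +kernel
  have hm' : ((463 : ℕ) : ℤ) ∣ (((18570793 : ℚ) / 4096)).num - (178 : ℤ) * (((18570793 : ℚ) / 4096)).den := by decide +kernel
  have hpk : 11 * 40 = Nat.card (((⟨0, -1, 1, -4452, -110483⟩ : WeierstrassCurve ℤ).map (Int.castRingHom (ZMod 463))).toAffine.Point) := by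
    rw [minTwist19_card_463]
  exact localNondivisible_of_chainB_rat (⟨0, -1, 1, -4452, -110483⟩ : WeierstrassCurve ℤ) 463 hq minTwist19_nonsingular_P hx hy hm hm' hpk
    chain463_mult (by convert chain463_ok)


/-! ## §3 The decisive prime -/

/-- **ROW `707a1` @ `(11, -19)`: THE DECISIVE PRIME `463` — bit ⟺ unit `δ̃_463(T₀)`.** For every imaginary quadratic `K`
with `d_K = -19`, granted the named facts displayed and the E-side record claim `hδE`: «some frame, some Kolyvagin PRIME
`ℓ`, some Kolyvagin–Heegner datum of conductor `ℓ` with `c_1(ℓ) ≠ 0`» (the depth-table bit) holds IF AND ONLY IF «every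
datum `D` of `T₀` at level `N_{T₀}` with `11 ∤ c_D` and the period transfer has a UNIT mod-`11` Kurihara number AT `463`» —
the claim of a future tree record `cert_<T₀>` @ `(11, 463)`. (⟹): bit ⟹ `#Sel_11(E^{(-19)}) ≤ 11` (§1 ∘ v18's twist IFF)
⟹ unit at `463` (`twistKuriharaClaim_prime_of_natCard_selmerGroup_le` with the kernel certificate `minTwist19_localNondivisible_463`);
(⟸): §1 with `m = 463` (`minTwist19_isCyclicKolyvaginLevel_11_463`, `ν(463) = 1`). CONDITIONAL on the named facts and the claim;
per curve; BSD is not proved by it. [cite: Sakamoto2022pSelmer, Lemma 4.4, Lemma 4.6 (1), Thm. 1.2, Thm. 1.5]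
[cite: Kim2022StructureSelmer, Thm. 1.11] [cite: CremonaAlgorithms1997, Table 1 (707a1)] -/
theorem twistKuriharaBit_iff_unit_463
    (h372 : GrossLMS1991.prop37_2_frobeniusCongruence)
    (h84 : Literature.NumberTheory.EllipticCurves.WZhang2014_lemma84_exists_minimal_kolyvaginClass_one_selmerCard)
    (hKim : Kim2022_card_selmerGroup_le_pow_of_kuriharaNumber_ne_zero)
    (hSak1 : Sakamoto2022_card_selmerGroup_eq_pow_of_isDeltaMinimal)
    (hSak2 : Sakamoto2022_exists_cyclicLevel_kuriharaNumber_ne_zero)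
    (hSak3 : Literature.NumberTheory.EllipticCurves.Sakamoto2022_kuriharaNumber_prime_ne_zero_of_localNondivisible)
    (hnf : exists_isNewformOf) (hMaz : mazur_not_dvd_maninConstant_of_odd)
    (K : Type) [Field K] [NumberField K] (hK : IsImaginaryQuadratic K) (hD : NumberField.discr K = -19)
    (hδE : haveI := isElliptic_c707a1; haveI := isGloballyMinimal_c707a1;
      haveI : NeZero (((⟨0, 1, 1, -12, 12⟩ : WeierstrassCurve ℤ).map (Int.castRingHom ℚ)).conductorNorm ℤ) := neZero_conductorNorm_of_isElliptic _;
      haveI := Fact.mk (by norm_num : Nat.Prime 11);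
      ∀ (D : ModularParametrizationData ((⟨0, 1, 1, -12, 12⟩ : WeierstrassCurve ℤ).map (Int.castRingHom ℚ)) (((⟨0, 1, 1, -12, 12⟩ : WeierstrassCurve ℤ).map (Int.castRingHom ℚ)).conductorNorm ℤ)), ¬ ((11 : ℕ) : ℤ) ∣ D.maninConstant →
        (∃ u : ℚ, ‖(u : ℚ_[11])‖ = 1 ∧ ((⟨0, 1, 1, -12, 12⟩ : WeierstrassCurve ℤ).map (Int.castRingHom ℚ)).realPeriodRat = u * plusPeriod D.f) →
        ∃ ψ : (ℓ : ℕ) → (ZMod ℓ)ˣ →* Multiplicative (ZMod 11),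
          (∀ ℓ ∈ (591251 : ℕ).primeFactors, Function.Surjective (ψ ℓ)) ∧ kuriharaNumber D.f 11 591251 ψ ≠ 0) :
    haveI := isElliptic_c707a1; haveI := isGloballyMinimal_c707a1;
    haveI : NeZero (((⟨0, 1, 1, -12, 12⟩ : WeierstrassCurve ℤ).map (Int.castRingHom ℚ)).conductorNorm ℤ) := neZero_conductorNorm_of_isElliptic _;
    haveI := minTwist19_isElliptic; haveI := minTwist19_isGloballyMinimal;
    haveI : NeZero (((⟨0, -1, 1, -4452, -110483⟩ : WeierstrassCurve ℤ).map (Int.castRingHom ℚ)).conductorNorm ℤ) := neZero_conductorNorm_of_isElliptic _;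
    haveI := Fact.mk (by norm_num : Nat.Prime 11);
    (∃ (Dt : ModularParametrizationData ((⟨0, 1, 1, -12, 12⟩ : WeierstrassCurve ℤ).map (Int.castRingHom ℚ)) (((⟨0, 1, 1, -12, 12⟩ : WeierstrassCurve ℤ).map (Int.castRingHom ℚ)).conductorNorm ℤ)) (β : ℤ)
      (ι : K →+* ℂ) (ℓ : ℕ) (d : KolyvaginHeegnerData Dt β ι ℓ),
      ℓ.Prime ∧ Zhang2014.IsKolyvaginPrime (((⟨0, 1, 1, -12, 12⟩ : WeierstrassCurve ℤ).map (Int.castRingHom ℚ)).conductorNorm ℤ) ((⟨0, 1, 1, -12, 12⟩ : WeierstrassCurve ℤ).map (Int.castRingHom ℚ)) K 11 ℓ ∧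
        d.kolyvaginClass (p := 11) (by norm_num) 1 ≠ 0) ↔
    (∀ (D : ModularParametrizationData ((⟨0, -1, 1, -4452, -110483⟩ : WeierstrassCurve ℤ).map (Int.castRingHom ℚ))
          (((⟨0, -1, 1, -4452, -110483⟩ : WeierstrassCurve ℤ).map (Int.castRingHom ℚ)).conductorNorm ℤ)),
        ¬ ((11 : ℕ) : ℤ) ∣ D.maninConstant →
        (∃ u : ℚ, ‖(u : ℚ_[11])‖ = 1 ∧
          ((⟨0, -1, 1, -4452, -110483⟩ : WeierstrassCurve ℤ).map (Int.castRingHom ℚ)).realPeriodRat = u * plusPeriod D.f) →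
        ∃ ψ : (q : ℕ) → (ZMod q)ˣ →* Multiplicative (ZMod 11),
          (∀ q ∈ (463 : ℕ).primeFactors, Function.Surjective (ψ q)) ∧ kuriharaNumber D.f 11 463 ψ ≠ 0) := by
  haveI := isElliptic_c707a1
  haveI := isGloballyMinimal_c707a1
  haveI iNZ : NeZero (((⟨0, 1, 1, -12, 12⟩ : WeierstrassCurve ℤ).map (Int.castRingHom ℚ)).conductorNorm ℤ) :=
    neZero_conductorNorm_of_isElliptic _
  haveI := minTwist19_isElliptic
  haveI := minTwist19_isGloballyMinimal
  haveI iNZT : NeZero (((⟨0, -1, 1, -4452, -110483⟩ : WeierstrassCurve ℤ).map (Int.castRingHom ℚ)).conductorNorm ℤ) :=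
    neZero_conductorNorm_of_isElliptic _
  haveI iP := Fact.mk (by norm_num : Nat.Prime 11)
  haveI : Fact (Nat.Prime 463) := ⟨by norm_num⟩
  haveI : NeZero (463 : ℕ) := ⟨by norm_num⟩
  have hsur : ((⟨0, 1, 1, -12, 12⟩ : WeierstrassCurve ℤ).map (Int.castRingHom ℚ)).HasSurjectiveModNGaloisRep ((11 : ℕ) : ℤ) := by
    simpa using hasSurjectiveModNGaloisRep_11
  have hpD : ¬ (((11 : ℕ) : ℤ) ∣ NumberField.discr K) := by rw [hD]; decide
  have hC : (⟨1, (-6 : ℚ), (0 : ℚ), -((1 : ℚ) / 2)⟩ : WeierstrassCurve.VariableChange ℚ) • ((⟨0, -1, 1, -4452, -110483⟩ : WeierstrassCurve ℤ).map (Int.castRingHom ℚ)) =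
      ((⟨0, 1, 1, -12, 12⟩ : WeierstrassCurve ℤ).map (Int.castRingHom ℚ)).quadraticTwist ((NumberField.discr K : ℤ) : ℚ) := by
    rw [hD]; push_cast; exact minTwist19_smul_eq
  have hiff := kolyvaginPrime_iff_twistKuriharaBit_11_neg19 h372 h84 hKim hSak1 hSak2 hnf hMaz K hK hD hδE
  constructor
  · intro hbit D hc hu
    have hT := (natCard_selmerGroup_quadraticTwist_le_iff_kuriharaBit hKim hSak1 hSak2 hnf hMaz _ 11 (by norm_num) goodOrdinary_11.1
      goodOrdinary_11.2 hsur (NumberField.discr_ne_zero K) hpD _ _ hC minTwist19_nonAnomalous_11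
      minTwist19_kodairaNeron_11 1).mpr (hiff.mp hbit)
    rw [pow_one] at hT
    exact twistKuriharaClaim_prime_of_natCard_selmerGroup_le hSak3 _ 11 (by norm_num) goodOrdinary_11.1 goodOrdinary_11.2 hsur
      (NumberField.discr_ne_zero K) hpD _ _ hC minTwist19_nonAnomalous_11 minTwist19_kodairaNeron_11 hT 463
      minTwist19_isCyclicKolyvaginLevel_11_463 _ minTwist19_localNondivisible_463 D hc hu
  · intro hunit
    refine hiff.mpr fun D hc hu ↦ ?_
    obtain ⟨ψ, hψ, hne⟩ := hunit D hc hu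
    refine ⟨463, inferInstance, minTwist19_isCyclicKolyvaginLevel_11_463, ?_, ψ, hψ, hne⟩
    rw [Nat.Prime.primeFactors (by norm_num), Finset.card_singleton]

end C707a1

end Summit.BirchSwinnertonDyer.BirchSwinnertonDyer.Theorems.KolyvaginDepthDoor

end
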